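import Literature.MathematicalPhysics.QuantumLattice.YangMillsCasimirSplit
import Literature.MathematicalPhysics.QuantumLattice.YangMillsHeatFlowEnergy
import Literature.Analysis.Calculus.PlanarRotation
import Literature.Analysis.Calculus.SphereSpectralShell
import HarnessLib

/-!
# Skew-symmetry of the total angular momentum on `L²(S_r)`

QuantumLattice support file (everything proved; one abbreviation, no named facts) on the proof
path of `Literature.MathematicalPhysics.QuantumLattice.Waldron2019_yangMillsFlow_flatTorus`
(A. Waldron, Invent. math. 217 (2019)), §4 done extrinsically: the covariant total angular
momentum `J_{ij}` (`angJ`, `YangMillsCasimirSplit`) is skew-symmetric on bilinear-map fields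
for the `L²(S_r)` pairing `∑ₖ∑ₗ ∮ ip(β(bₖ,bₗ), β'(bₖ,bₗ))` built from ANY continuous bilinear
pairing `ip` on the coefficient algebra `𝔸` which is `ad`-invariant along the connection
(`ip([a,X],Y) + ip(X,[a,Y]) = 0` for `a` in the range of `A`; e.g. the Hilbert–Schmidt product on
`M_N(ℂ)` for `𝔲(N)`-valued `A`, `frobenius_inner_lie_left_add_right`):

* `inner_angularField_antisymm` — `⟨L u, w⟩ = −⟨u, L w⟩`;
* `sum_sum_ip_spin_left/right` — pointwise skewness of the spin part;
* `ip_covDeriv_add_ip_covDeriv` — metric compatibility `ip(D_uφ,ψ) + ip(φ,D_uψ) = ∂_u ip(φ,ψ)`;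
* `sphereIntegral_angJ_skew` — **`∑ₖ∑ₗ ∮_{S_r} (ip((J_{ij}β)ₖₗ, β'ₖₗ) + ip(βₖₗ, (J_{ij}β')ₖₗ)) = 0`**;
  with `β' = Jβ` and `ip` symmetric this is `∮ ip(β, J²β) = −∮ ip(Jβ, Jβ)`, the step
  `∫⟨Ω, −Δ_θΩ⟩ = ‖…‖²` of Waldron's (spherical5) in the `J` formalism.

References: A. Waldron, Invent. math. 217 (2019), §4.2 [Waldron2019].
-/

noncomputable section

open scoped RealInnerProductSpace Topology
open MeasureTheory Set Metric
open Literature.Analysis.Calculus Literature.Analysis.FluidPDE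

namespace Literature.MathematicalPhysics.QuantumLattice

section AngularIBP

variable {E : Type*} [NormedAddCommGroup E] [InnerProductSpace ℝ E]
variable {𝔸 : Type*} [NormedRing 𝔸] [NormedAlgebra ℝ 𝔸]
variable {ι : Type*} [Fintype ι]

/-- Bilinear-map fields `y ↦ (β_y : E × E → 𝔸)` (e.g. `curvatureCLM A`). The abbreviation fixes
the topology of `𝔸` to its norm topology inside the `→L` types. [folklore] -/
abbrev BilinField (E : Type*) [NormedAddCommGroup E] [InnerProductSpace ℝ E] (𝔸 : Type*)
    [NormedRing 𝔸] [NormedAlgebra ℝ 𝔸] : Type _ :=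
  E → E →L[ℝ] E →L[ℝ] 𝔸

omit [Fintype ι] in
/-- The angular fields are antisymmetric: `⟨L u, w⟩ = −⟨u, L w⟩`. [folklore] -/
theorem inner_angularField_antisymm [Fintype ι] (b : OrthonormalBasis ι ℝ E) (i j : ι) (u w : E) :
    ⟪angularField b i j u, w⟫ = -⟪u, angularField b i j w⟫ := by
  rw [real_inner_comm (angularField b i j w) u, inner_angularField, inner_angularField,
    real_inner_comm (b j) w, real_inner_comm (b i) w, real_inner_comm (b j) u, real_inner_comm (b i) u]
  ring

/-! ### The spin part is pointwise skew -/

/-- For bilinear `β, β'` and a bilinear pairing `ip`: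
`∑ₖ∑ₗ ip(β(L bₖ, bₗ), β'(bₖ,bₗ)) = −∑ₖ∑ₗ ip(β(bₖ,bₗ), β'(L bₖ, bₗ))`. [folklore] -/
theorem sum_sum_ip_spin_left (b : OrthonormalBasis ι ℝ E) (i j : ι) (ip : 𝔸 →L[ℝ] 𝔸 →L[ℝ] ℝ)
    (β β' : E →L[ℝ] E →L[ℝ] 𝔸) :
    ∑ k, ∑ l, ip (β (angularField b i j (b k)) (b l)) (β' (b k) (b l)) =
      -∑ k, ∑ l, ip (β (b k) (b l)) (β' (angularField b i j (b k)) (b l)) := by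
  have hexp : ∀ k, angularField b i j (b k) = ∑ p, ⟪angularField b i j (b k), b p⟫ • b p := by
    intro k
    conv_lhs => rw [← b.sum_repr' (angularField b i j (b k))]
    exact Finset.sum_congr rfl fun p _ => by rw [real_inner_comm]
  set c : ι → ι → ℝ := fun k p => ⟪angularField b i j (b k), b p⟫ with hc
  have hanti : ∀ k p, c p k = -c k p := fun k p => by
    simp only [hc]; rw [inner_angularField_antisymm, real_inner_comm]
  have hL : ∀ k l, ip (β (angularField b i j (b k)) (b l)) (β' (b k) (b l)) =
      ∑ p, c k p * ip (β (b p) (b l)) (β' (b k) (b l)) := by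
    intro k l
    rw [hexp k]
    simp only [map_sum, map_smul, FunLike.coe_sum, FunLike.coe_smul, Finset.sum_apply,
      Pi.smul_apply, smul_eq_mul, hc]
  have hR : ∀ k l, ip (β (b k) (b l)) (β' (angularField b i j (b k)) (b l)) =
      ∑ p, c k p * ip (β (b k) (b l)) (β' (b p) (b l)) := by
    intro k l
    conv_lhs => rw [hexp k]
    simp only [map_sum, map_smul, FunLike.coe_sum, FunLike.coe_smul, Finset.sum_apply,
      Pi.smul_apply, smul_eq_mul, hc]
  simp_rw [hL, hR]
  rw [← Finset.sum_neg_distrib]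
  calc ∑ k, ∑ l, ∑ p, c k p * ip (β (b p) (b l)) (β' (b k) (b l))
      = ∑ l, ∑ k, ∑ p, c k p * ip (β (b p) (b l)) (β' (b k) (b l)) := Finset.sum_comm
    _ = ∑ l, ∑ p, ∑ k, c k p * ip (β (b p) (b l)) (β' (b k) (b l)) :=
        Finset.sum_congr rfl fun l _ => Finset.sum_comm
    _ = ∑ l, ∑ p, -∑ k, c p k * ip (β (b p) (b l)) (β' (b k) (b l)) := by
        refine Finset.sum_congr rfl fun l _ => Finset.sum_congr rfl fun p _ => ?_
        rw [← Finset.sum_neg_distrib]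
        exact Finset.sum_congr rfl fun k _ => by rw [hanti p k]; ring
    _ = ∑ p, -∑ l, ∑ k, c p k * ip (β (b p) (b l)) (β' (b k) (b l)) := by
        rw [Finset.sum_comm]; simp [Finset.sum_neg_distrib]

/-- For bilinear `β, β'`: `∑ₖ∑ₗ ip(β(bₖ, L bₗ), β'(bₖ,bₗ)) = −∑ₖ∑ₗ ip(β(bₖ,bₗ), β'(bₖ, L bₗ))`.
[folklore] -/
theorem sum_sum_ip_spin_right (b : OrthonormalBasis ι ℝ E) (i j : ι) (ip : 𝔸 →L[ℝ] 𝔸 →L[ℝ] ℝ)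
    (β β' : E →L[ℝ] E →L[ℝ] 𝔸) :
    ∑ k, ∑ l, ip (β (b k) (angularField b i j (b l))) (β' (b k) (b l)) =
      -∑ k, ∑ l, ip (β (b k) (b l)) (β' (b k) (angularField b i j (b l))) := by
  have h := sum_sum_ip_spin_left b i j ip β.flip β'.flip
  simp only [ContinuousLinearMap.flip_apply] at h
  rw [Finset.sum_comm] at h
  rw [h, Finset.sum_comm]

/-! ### Metric compatibility -/

/-- **Metric compatibility of the covariant derivative** for an `ad`-invariant bilinear pairing:
if `ip([A_x u, X], Y) + ip(X, [A_x u, Y]) = 0` for all `X, Y`, then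
`ip(D_uφ, ψ) + ip(φ, D_uψ) = ∂_u ip(φ, ψ)`. [folklore] -/
theorem ip_covDeriv_add_ip_covDeriv (ip : 𝔸 →L[ℝ] 𝔸 →L[ℝ] ℝ) {A : Connection E 𝔸} {x : E}
    {u : E} (had : ∀ X Y, ip ⁅A x u, X⁆ Y + ip X ⁅A x u, Y⁆ = 0) {φ ψ : E → 𝔸}
    (hφ : DifferentiableAt ℝ φ x) (hψ : DifferentiableAt ℝ ψ x) :
    ip (covDeriv A φ x u) (ψ x) + ip (φ x) (covDeriv A ψ x u) =
      fderiv ℝ (fun y => ip (φ y) (ψ y)) x u := by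
  have hc : DifferentiableAt ℝ (fun y => ip (φ y)) x := ip.differentiableAt.comp x hφ
  rw [fderiv_clm_apply hc hψ]
  have h2 : fderiv ℝ (fun y => ip (φ y)) x = (ip : 𝔸 →L[ℝ] 𝔸 →L[ℝ] ℝ).comp (fderiv ℝ φ x) :=
    (ip.hasFDerivAt.comp x hφ.hasFDerivAt).fderiv
  rw [h2]
  simp only [covDeriv, map_add, FunLike.coe_add, Pi.add_apply, ContinuousLinearMap.comp_apply,
    ContinuousLinearMap.flip_apply]
  linarith [had (φ x) (ψ x)]

/-! ### The `L²(S_r)`-skewness of `J` -/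

variable [FiniteDimensional ℝ E] [MeasurableSpace E] [BorelSpace E]

/-- **Skew-symmetry of the covariant total angular momentum on `L²(S_r)`.** For a connection
`A` whose values are `ip`-skew (`ip([A_y v, X], Y) + ip(X, [A_y v, Y]) = 0`), `C¹` bilinear-map
fields `β, β'` off the origin and `r > 0`:
`∑ₖ∑ₗ ∮_{S_r} (ip((J_{ij}β)(bₖ,bₗ), β'(bₖ,bₗ)) + ip(β(bₖ,bₗ), (J_{ij}β')(bₖ,bₗ))) = 0`.
[folklore] -/
theorem sphereIntegral_angJ_skew [Nontrivial E] (b : OrthonormalBasis ι ℝ E) (i j : ι)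
    (ip : 𝔸 →L[ℝ] 𝔸 →L[ℝ] ℝ) {A : Connection E 𝔸}
    (had : ∀ y v X Y, ip ⁅A y v, X⁆ Y + ip X ⁅A y v, Y⁆ = 0)
    {β β' : BilinField E 𝔸} (hβ : ContDiffOn ℝ 1 β {0}ᶜ)
    (hβ' : ContDiffOn ℝ 1 β' {0}ᶜ) {r : ℝ} (hr : 0 < r) :
    sphereIntegral (volume : Measure E) (fun x => ∑ k, ∑ l,
      (ip (angJ b i j A (fun y a c => β y a c) x (b k) (b l)) (β' x (b k) (b l)) +
        ip (β x (b k) (b l)) (angJ b i j A (fun y a c => β' y a c) x (b k) (b l)))) r = 0 := by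
  have hO : IsOpen ({0}ᶜ : Set E) := isOpen_compl_singleton
  -- the component functions
  have hβc : ∀ k l, ContDiffOn ℝ 1 (fun y => β y (b k) (b l)) {0}ᶜ := fun k l =>
    (hβ.clm_apply contDiffOn_const).clm_apply contDiffOn_const
  have hβ'c : ∀ k l, ContDiffOn ℝ 1 (fun y => β' y (b k) (b l)) {0}ᶜ := fun k l =>
    (hβ'.clm_apply contDiffOn_const).clm_apply contDiffOn_const
  -- the scalar products `q_{kl} = ip(β_{kl}, β'_{kl})` and their angular derivatives
  have hq : ∀ k l, ContDiffOn ℝ 1 (fun y => ip (β y (b k) (b l)) (β' y (b k) (b l))) {0}ᶜ :=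
    fun k l => ((ip.contDiff.comp_contDiffOn (hβc k l)).clm_apply (hβ'c k l))
  have hIBP : ∀ k l, sphereIntegral (volume : Measure E)
      (fun x => fderiv ℝ (fun y => ip (β y (b k) (b l)) (β' y (b k) (b l))) x (angularField b i j x)) r
        = 0 := by
    intro k l
    by_cases hij : i = j
    · subst hij
      have : ∀ x : E, angularField b i i x = 0 := fun x => by simp [angularField]
      simp only [this, map_zero]
      simp [sphereIntegral_def]
    · have h := sphereIntegral_fderiv_angular_eq_zero (E := E) (b.orthonormal.1 i)
        (b.orthonormal.1 j) (b.orthonormal.2 hij) (hq k l) hr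
      simpa [angularField] using h
  -- pointwise: orbital part = angular derivative of `q_{kl}`, spin part cancels
  have hpt : ∀ x, ‖x‖ = r → (∑ k, ∑ l,
      (ip (angJ b i j A (fun y a c => β y a c) x (b k) (b l)) (β' x (b k) (b l)) +
        ip (β x (b k) (b l)) (angJ b i j A (fun y a c => β' y a c) x (b k) (b l)))) =
      ∑ k, ∑ l, fderiv ℝ (fun y => ip (β y (b k) (b l)) (β' y (b k) (b l))) x (angularField b i j x) := by
    intro x hx
    have hx0 : x ∈ ({0}ᶜ : Set E) := mem_compl_zero_of_norm_eq hr hx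
    have hβd : ∀ k l, DifferentiableAt ℝ (fun y => β y (b k) (b l)) x := fun k l =>
      ((hβc k l).differentiableOn one_ne_zero).differentiableAt (hO.mem_nhds hx0)
    have hβ'd : ∀ k l, DifferentiableAt ℝ (fun y => β' y (b k) (b l)) x := fun k l =>
      ((hβ'c k l).differentiableOn one_ne_zero).differentiableAt (hO.mem_nhds hx0)
    have horb : ∀ k l,
        ip (covDeriv A (fun y => β y (b k) (b l)) x (angularField b i j x)) (β' x (b k) (b l)) +
        ip (β x (b k) (b l)) (covDeriv A (fun y => β' y (b k) (b l)) x (angularField b i j x)) =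
        fderiv ℝ (fun y => ip (β y (b k) (b l)) (β' y (b k) (b l))) x (angularField b i j x) :=
      fun k l => ip_covDeriv_add_ip_covDeriv ip (had x _) (hβd k l) (hβ'd k l)
    have hspinL := sum_sum_ip_spin_left b i j ip (β x) (β' x)
    have hspinR := sum_sum_ip_spin_right b i j ip (β x) (β' x)
    simp only [angJ, map_add, FunLike.coe_add, Pi.add_apply, Finset.sum_add_distrib]
    rw [hspinL, hspinR]
    have hsum : ∑ k, ∑ l, ip (covDeriv A (fun y => β y (b k) (b l)) x (angularField b i j x))
        (β' x (b k) (b l)) + ∑ k, ∑ l, ip (β x (b k) (b l))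
          (covDeriv A (fun y => β' y (b k) (b l)) x (angularField b i j x)) =
        ∑ k, ∑ l, fderiv ℝ (fun y => ip (β y (b k) (b l)) (β' y (b k) (b l))) x (angularField b i j x) := by
      rw [← Finset.sum_add_distrib]
      refine Finset.sum_congr rfl fun k _ => ?_
      rw [← Finset.sum_add_distrib]
      exact Finset.sum_congr rfl fun l _ => horb k l
    linarith [hsum]
  rw [sphereIntegral_congr_norm hr.le hpt]
  have hcont : ∀ k l, ContinuousOn
      (fun x => fderiv ℝ (fun y => ip (β y (b k) (b l)) (β' y (b k) (b l))) x (angularField b i j x)) {0}ᶜ :=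
    fun k l => ((hq k l).continuousOn_fderiv_of_isOpen hO le_rfl).clm_apply
      (continuous_angularField b i j).continuousOn
  rw [sphereIntegral_sum_of Finset.univ (fun k x => ∑ l,
      fderiv ℝ (fun y => ip (β y (b k) (b l)) (β' y (b k) (b l))) x (angularField b i j x))
    (fun k _ => continuousOn_finsetSum _ fun l _ => hcont k l) hr]
  refine Finset.sum_eq_zero fun k _ => ?_
  rw [sphereIntegral_sum_of Finset.univ (fun l x =>
      fderiv ℝ (fun y => ip (β y (b k) (b l)) (β' y (b k) (b l))) x (angularField b i j x))
    (fun l _ => hcont k l) hr]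
  exact Finset.sum_eq_zero fun l _ => hIBP k l

end AngularIBP

end Literature.MathematicalPhysics.QuantumLattice
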